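import Literature.NumberTheory.LFunctions.Zhang2022.Section12Top1225ExHolds
import Literature.NumberTheory.LFunctions.Zhang2022.RepairGapSection12U030Premise15
import Literature.NumberTheory.LFunctions.Zhang2022.RepairGapSection8FrontEnd82Premise
import Literature.NumberTheory.LFunctions.Zhang2022.RepairGapLemma82LeafPremise
import Literature.NumberTheory.LFunctions.Zhang2022.RepairGapPartIIIDoors
import HarnessLib

/-!
# Zhang (2022), rescue GAP/BED (D-0124 (3)(4)): the §12 top-range evaluation node (12.13) (`Typed.Sec12C.Top1225Ex`)
# under the minimum premise `‖L(1,χ)‖ ≤ 𝓛⁻¹⁵` — UNCONDITIONAL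

Topic `Literature/NumberTheory/LFunctions/Zhang2022` (Landau–Siegel audit tree; verdict-neutral).
Y. Zhang, *Discrete mean estimates and the Landau–Siegel zero*, arXiv:2211.02515v1 (2022)
[Zhang2022LandauSiegel] — **an unrefereed manuscript under adjudication; nothing in this file asserts or
denies its Theorems 1–2, and nothing here is a claim about Landau–Siegel zeros. The programme SEARCHES and
TYPES; no claim about Landau–Siegel zeros, Theorems 1–2 of arXiv:2211.02515 or a repaired Margin232 until a
kernel theorem says so.**

The node `Typed.Sec12C.Top1225Ex c′` (Z22:(12.13), p. 71: «‖S_j(𝐚₁₂,𝐚₂₅)|_{P″₁<dr<P₂} − main‖ ≤ εα», reading of record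
RT-02/R-18; the binder `hTop1225` of `Sec12D.eval1217Rel_of_exact` in the whole-DAG theorem) is a tree theorem through
`top1225Ex_of_u030Rel`: inputs §9.u002 (Lemma 8.2 at `x = P₃/dr`, `Section9Discharge.step9u002_sharp` over the leaf
`Skeleton.lemma82_holds`), §8.u041 (`Section8FrontEnd82.step8u041_holds`), the relative ε-free Lemma 12.3
(`Sec12B.lemma123FormRel_of_u030Rel` over u030), and guard-free engines ((8.10), the evaluation rule, `Top1225.core_topRel`).
Every (A)-input is now kernel at exponent 15: `Skeleton.lemma82_pow15` (p592479), `Section8FrontEnd82.step8u041_pow15`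
(p613435), `Typed.Sec12B.u030Rel_pow15` (p612903). This file re-runs the three remaining edges VERBATIM with the guard text
swapped:

* `Section9Discharge.step9u002_sharp_pow15` — §9.u002 from the `𝓛⁻¹⁵` Lemma 8.2 body (same constant `3·max C 0`);
* `Typed.Sec12B.lemma123FormRel_pow15` — the body of `Lemma123FormRel c′` with guard `‖L(1,χ)‖ ≤ 𝓛⁻¹⁵`, UNCONDITIONAL (edge
  `lemma123FormRel_of_u030Rel` at `u030Rel_pow15`; u029 / u031 / u033 are guard-free tree theorems);
* `Typed.Sec12C.top1225Ex_pow15` — **the body of the node `Top1225Ex c′` with guard `‖L(1,χ)‖ ≤ 𝓛⁻¹⁵`, for every `c′ ≥ 0`,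
  UNCONDITIONAL** (edge `top1225Ex_of_lemma123FormRel` verbatim); `top1225Ex_of_assumptionAWith` — every real `E ≥ 15` (at
  `E = 2022` the body of the tree theorem `top1225Ex_holds`, not restated).

GAP reading (as-typed; row G-31, §12 layer): the first §12 EVALUATION NODE of the (12.17) chain kernel at (A)-exponent 15 (after
the leaves and the u030 step). Theorems only; no definition, no named fact; nothing about (A) itself. Private helpers copied
unchanged from the three tree files.

## References

* Y. Zhang, arXiv:2211.02515v1 (2022), §12 (12.13) p. 71, Lemma 12.3 pp. 70–71; §9 p. 51; §8 p. 47, Lemma 8.2.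
  [cite: Zhang2022LandauSiegel, §12 (12.13) p.71]
-/

noncomputable section

open Complex Real ComplexConjugate

/-! ## §9.u002 from the `𝓛⁻¹⁵` Lemma 8.2 -/

namespace Literature.NumberTheory.LFunctions.Zhang2022.Section9Discharge

open Skeleton Section9Statements

variable (c' : ℝ)

/-- Eventually `log D ≥ L₀`. [cite: Zhang2022LandauSiegel, §2 p.4] -/
private theorem forAllLarge_log_ge'' (L₀ : ℝ) : ForAllLarge fun D _ _ => L₀ ≤ Real.log D := by
  refine ForAllLarge.of_le ⌈Real.exp L₀⌉₊ fun D _ χ hD _ _ => ?_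
  have hexp : Real.exp L₀ ≤ D := le_trans (Nat.le_ceil _) (by exact_mod_cast hD)
  exact (Real.le_log_iff_exp_le (lt_of_lt_of_le (Real.exp_pos _) hexp)).mpr hexp

/-- `T > 0`. [cite: Zhang2022LandauSiegel, §6] -/
private theorem bigT_pos' (D : ℕ) : 0 < bigT D := Real.exp_pos _

/-- `P₂, P₃ > 0`. [cite: Zhang2022LandauSiegel, §2 (2.21)] -/
private theorem P2_pos_P3_pos' (D : ℕ) : 0 < Skeleton.P2 D ∧ 0 < P3 D :=
  ⟨div_pos (Real.rpow_pos_of_pos (Real.exp_pos _) _) (pow_pos (Real.exp_pos _) _),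
    Real.rpow_pos_of_pos (Real.exp_pos _) _⟩

/-- `log P₃ = 0.498𝓛⁹`. [cite: Zhang2022LandauSiegel, §2 (2.21)] -/
private theorem log_P3' {D : ℕ} : Real.log (P3 D) = 0.498 * ell D ^ 9 := by
  have hP : 0 < bigP D := Real.exp_pos _
  rw [P3, Real.log_rpow hP, log_bigP]

/-- For `𝓛 ≥ 2`: `1 < P`, `P₃ < P`, `P₃ ≤ PT⁻²`, `1 ≤ log P₃`. [cite: Zhang2022LandauSiegel, §2 (2.6), (2.21)] -/
private theorem P3_facts' {D : ℕ} (hD : 2 ≤ Real.log D) :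
    1 < bigP D ∧ P3 D < bigP D ∧ P3 D ≤ bigP D / bigT D ^ 2 ∧ 1 ≤ Real.log (P3 D) := by
  have hℓ : 2 ≤ ell D := by rw [ell]; exact hD
  have hP : 1 < bigP D := by
    rw [bigP]; exact Real.one_lt_exp_iff.mpr (by positivity)
  refine ⟨hP, ?_, (P3_le_P1 D).trans (P1_le_P_div_T_sq D hD), ?_⟩
  · rw [P3]
    conv_rhs => rw [← Real.rpow_one (bigP D)]
    exact Real.rpow_lt_rpow_of_exponent_lt hP (by norm_num)
  · rw [log_P3']
    have : (2:ℝ) ^ 9 ≤ ell D ^ 9 := pow_le_pow_left₀ (by norm_num) hℓ 9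
    nlinarith

/-- **`Z22:§9.u002` (sharp form) from Lemma 8.2 UNDER THE MINIMUM PREMISE** (twin of `step9u002_sharp`: hypothesis = the
body of `Skeleton.Lemma82 c′` with guard `‖L(1,χ)‖ ≤ 𝓛⁻¹⁵` — i.e. `Skeleton.lemma82_pow15` — and the same guard on the
conclusion; proof verbatim, constant `3·max C 0`). [cite: Zhang2022LandauSiegel, §9 p.51, tex L2605–L2608] -/
theorem step9u002_sharp_pow15 :
    (∃ C : ℝ, ForAllLarge fun D _ χ => ‖χ.LFunction 1‖ ≤ 1 / Real.log D ^ 15 →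
      ∀ j ∈ ({1, 2, 3} : Finset ℕ), ∀ μ ∈ ({6, 7} : Finset ℕ), ∀ y : ℝ, bigT D < y → y < bigP D →
        ‖(∑ m ∈ Finset.Ico 1 ⌈y⌉₊, χ (m : ZMod D) / (m : ℂ) ^ (1 - betaJ c' D j) *
              ((y / m : ℝ) : ℂ) ^ betaMu D μ * (Real.log (y / m) : ℂ)) -
            deriv χ.LFunction 1 * frakfW c' D j μ y‖ ≤ C * (ell D ^ 6)⁻¹) → ∃ C : ℝ, ForAllLarge fun D _ χ => ‖χ.LFunction 1‖ ≤ 1 / Real.log D ^ 15 →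
      ∀ j ∈ ({1, 2, 3} : Finset ℕ), ∀ d r : ℕ, 1 ≤ d → 1 ≤ r →
        ((d * r : ℕ) : ℝ) < P3 D / bigT D →
          ‖(∑ m ∈ Finset.Ico 1 (Nsupp D),
                χ (m : ZMod D) * vk3 D (d * r * m) / (m : ℂ) ^ (1 - betaJ c' D j)) -
              deriv χ.LFunction 1 / (Real.log (P3 D) : ℂ) *
                frakfW c' D j 6 (P3 D / ((d * r : ℕ) : ℝ))‖ ≤ C * (ell D ^ 15)⁻¹ := by
  rintro ⟨C, hC⟩
  refine ⟨3 * max C 0, ?_⟩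
  refine (hC.and (forAllLarge_log_ge'' 2)).mono ?_
  intro D _ χ _ _ ⟨H82, HL⟩ hA j hj d r hd hr hdr
  obtain ⟨hP1, hP3P, hP3T, hlog1⟩ := P3_facts' (D := D) HL
  have hP3pos : 0 < P3 D := (P2_pos_P3_pos' D).2
  have hdr0 : 0 < ((d * r : ℕ) : ℝ) := by
    have : 1 ≤ d * r := Nat.one_le_iff_ne_zero.mpr (Nat.mul_ne_zero (by omega) (by omega))
    exact_mod_cast this
  set y : ℝ := P3 D / ((d * r : ℕ) : ℝ) with hy
  have hTy : bigT D < y := by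
    rw [hy, lt_div_iff₀ hdr0, mul_comm]; rwa [lt_div_iff₀ (bigT_pos' D)] at hdr
  have hyP3 : y ≤ P3 D := by
    rw [hy]; refine div_le_self hP3pos.le ?_
    have : 1 ≤ d * r := Nat.one_le_iff_ne_zero.mpr (Nat.mul_ne_zero (by omega) (by omega))
    exact_mod_cast this
  have hyP : y < bigP D := lt_of_le_of_lt hyP3 hP3P
  have key := H82 hA j hj 6 (by simp) y hTy hyP
  have hlogne : Real.log (P3 D) ≠ 0 := by linarith
  -- truncation: the `m`-sum of `S_j` over `Ico 1 (Nsupp D)` equals the sum over `Ico 1 ⌈y⌉₊`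
  have hceil : ⌈y⌉₊ ≤ Nsupp D := Nat.ceil_mono (hyP3.trans hP3T)
  have hsub : Finset.Ico 1 ⌈y⌉₊ ⊆ Finset.Ico 1 (Nsupp D) := Finset.Ico_subset_Ico_right hceil
  have hzero : ∀ m ∈ Finset.Ico 1 (Nsupp D), m ∉ Finset.Ico 1 ⌈y⌉₊ →
      χ (m : ZMod D) * vk3 D (d * r * m) / (m : ℂ) ^ (1 - betaJ c' D j) = 0 := by
    intro m hm hm'
    rw [Finset.mem_Ico] at hm
    rw [Finset.mem_Ico, not_and, not_lt] at hm'
    have hym : y ≤ m := Nat.ceil_le.mp (hm' hm.1)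
    have hge : ¬ ((d * r * m : ℕ) : ℝ) < P3 D := by
      rw [not_lt]
      have e1 : P3 D = y * ((d * r : ℕ) : ℝ) := by rw [hy, div_mul_cancel₀ _ hdr0.ne']
      have e2 : ((d * r * m : ℕ) : ℝ) = (m : ℝ) * ((d * r : ℕ) : ℝ) := by push_cast; ring
      rw [e1, e2]
      exact mul_le_mul_of_nonneg_right hym hdr0.le
    rw [vk3, if_neg hge]; simp
  rw [← Finset.sum_subset hsub hzero]
  -- summand identity
  have hterm : ∀ m ∈ Finset.Ico 1 ⌈y⌉₊,
      χ (m : ZMod D) * vk3 D (d * r * m) / (m : ℂ) ^ (1 - betaJ c' D j) =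
        (Real.log (P3 D) : ℂ)⁻¹ *
          (χ (m : ZMod D) / (m : ℂ) ^ (1 - betaJ c' D j) * ((y / m : ℝ) : ℂ) ^ betaMu D 6 *
            (Real.log (y / m) : ℂ)) := by
    intro m hm
    rw [Finset.mem_Ico] at hm
    have hmy : (m : ℝ) < y := Nat.lt_ceil.mp hm.2
    exact vk3_summand_eq c' χ j hdr0 hm.1 hlogne hmy
  rw [Finset.sum_congr rfl hterm, ← Finset.mul_sum]
  have hL : (Real.log (P3 D) : ℂ) ≠ 0 := by exact_mod_cast hlogne
  have e : (Real.log (P3 D) : ℂ)⁻¹ *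
        (∑ m ∈ Finset.Ico 1 ⌈y⌉₊, χ (m : ZMod D) / (m : ℂ) ^ (1 - betaJ c' D j) *
          ((y / m : ℝ) : ℂ) ^ betaMu D 6 * (Real.log (y / m) : ℂ)) -
        deriv χ.LFunction 1 / (Real.log (P3 D) : ℂ) * frakfW c' D j 6 y =
      (Real.log (P3 D) : ℂ)⁻¹ *
        ((∑ m ∈ Finset.Ico 1 ⌈y⌉₊, χ (m : ZMod D) / (m : ℂ) ^ (1 - betaJ c' D j) *
          ((y / m : ℝ) : ℂ) ^ betaMu D 6 * (Real.log (y / m) : ℂ)) -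
          deriv χ.LFunction 1 * frakfW c' D j 6 y) := by
    field_simp
  rw [e, norm_mul, norm_inv, Complex.norm_real, Real.norm_eq_abs, abs_of_pos (by linarith)]
  calc (Real.log (P3 D))⁻¹ * ‖(∑ m ∈ Finset.Ico 1 ⌈y⌉₊, χ (m : ZMod D) / (m : ℂ) ^ (1 - betaJ c' D j) *
          ((y / m : ℝ) : ℂ) ^ betaMu D 6 * (Real.log (y / m) : ℂ)) - deriv χ.LFunction 1 * frakfW c' D j 6 y‖
      ≤ (Real.log (P3 D))⁻¹ * (max C 0 * (ell D ^ 6)⁻¹) := by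
        have hℓ : 0 < ell D := by rw [ell]; linarith
        refine mul_le_mul_of_nonneg_left (key.trans ?_) (inv_nonneg.mpr (by linarith))
        exact mul_le_mul_of_nonneg_right (le_max_left _ _) (by positivity)
    _ = (max C 0 / 0.498) * (ell D ^ 15)⁻¹ := by
        have hℓ : 0 < ell D := by rw [ell]; linarith
        rw [log_P3']; field_simp
    _ ≤ 3 * max C 0 * (ell D ^ 15)⁻¹ := by
        have hℓ : 0 < ell D := by rw [ell]; linarith
        have h0 : 0 ≤ max C 0 := le_max_right _ _
        have : max C 0 / 0.498 ≤ 3 * max C 0 := by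
          rw [div_le_iff₀ (by norm_num)]; nlinarith
        exact mul_le_mul_of_nonneg_right this (by positivity)

end Literature.NumberTheory.LFunctions.Zhang2022.Section9Discharge

/-! ## The relative ε-free Lemma 12.3 at `𝓛⁻¹⁵` -/

namespace Literature.NumberTheory.LFunctions.Zhang2022.Typed.Sec12B

open Literature.NumberTheory.LFunctions.Zhang2022.Skeleton

variable (c' : ℝ) {D : ℕ}

/-- `α = π/𝓛⁹`. [cite: Zhang2022LandauSiegel, §2 (2.10)] -/
private theorem alpha_eq_div (D : ℕ) : alpha D = π / ell D ^ 9 := by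
  rw [alpha, bigP, Real.log_exp]

/-- `α > 0` for `D ≥ 3`. [cite: Zhang2022LandauSiegel, §2 (2.10)] -/
private theorem alpha_pos_three (hD : 3 ≤ D) : 0 < alpha D := by
  rw [alpha_eq_div]; exact div_pos Real.pi_pos (pow_pos (by linarith [one_lt_ell hD]) _)

/-- `log P₁ = 0.504·𝓛⁹`. [cite: Zhang2022LandauSiegel, §2 (2.21)] -/
private theorem log_P1_eq_ell (D : ℕ) : Real.log (Skeleton.P1 D) = 0.504 * ell D ^ 9 := by
  rw [Skeleton.P1, Real.log_rpow (by rw [bigP]; exact Real.exp_pos _), bigP, Real.log_exp]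

/-- `log P₁ > 0` for `D ≥ 3`. [cite: Zhang2022LandauSiegel, §2 (2.21)] -/
private theorem log_P1_pos_three (hD : 3 ≤ D) : 0 < Real.log (Skeleton.P1 D) := by
  rw [log_P1_eq_ell]; exact mul_pos (by norm_num) (pow_pos (by linarith [one_lt_ell hD]) _)

/-- **Lemma 12.3 (ε-free evaluation form, relative reading) UNDER THE MINIMUM PREMISE, UNCONDITIONAL** — the body of
`Sec12B.Lemma123FormRel c′` with guard `‖L(1,χ)‖ ≤ 𝓛⁻¹⁵` (twin of `lemma123FormRel_of_u030Rel`, proof verbatim, fed with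
`u030Rel_pow15`; constant `e^π|C|/(0.504π)`). [cite: Zhang2022LandauSiegel, §12 Lemma 12.3 (proof), pp.70–71] -/
theorem lemma123FormRel_pow15 :
    ∃ C : ℝ, ForAllLarge fun D _ χ => ‖χ.LFunction 1‖ ≤ 1 / Real.log D ^ 15 →
      ∀ j ∈ ({1, 2, 3} : Finset ℕ), ∀ d r : ℕ, 1 ≤ d → 1 ≤ r →
        P1pp D < ((d * r : ℕ) : ℝ) → ((d * r : ℕ) : ℝ) < Skeleton.P2 D →
          ‖sum122 c' χ j d r +
              1 / (Real.log (Skeleton.P1 D) : ℂ) * (deriv χ.LFunction 1 * PiW χ d r) * rhs033 c' D j d r‖ ≤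
            C * (ell D ^ 15)⁻¹ * (∏ q ∈ (d * r).primeFactors, (1 - (q : ℝ)⁻¹)⁻¹) ^ 2 := by
  obtain ⟨C, h30'⟩ := u030Rel_pow15 c'
  obtain ⟨D₀, hall⟩ := (((U029_holds c').and h30').and (U031_holds c')).and (U033_holds c')
  refine ⟨Real.exp π * |C| / (0.504 * π), max D₀ 3, fun D _ χ hD hq hp hA j hj d r hd hr h1 h2 => ?_⟩
  have hD₀ : D₀ ≤ D := le_trans (le_max_left _ _) hD
  have hD3 : 3 ≤ D := le_trans (le_max_right _ _) hD
  obtain ⟨⟨⟨k29, k30⟩, k31⟩, k33⟩ := hall D χ hD₀ hq hp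
  have e29 := k29 j hj d r hd hr h1 h2
  have e33 := k33 j hj d r hd hr h1 h2
  have hα : 0 < alpha D := alpha_pos_three hD3
  have hℓ : 0 < ell D := by linarith [one_lt_ell hD3]
  set R : ℝ := (∏ q ∈ (d * r).primeFactors, (1 - (q : ℝ)⁻¹)⁻¹) ^ 2 with hRdef
  have hR : 0 < R := lt_of_lt_of_le one_pos (Section8FrontEnd44ReductionRel.one_le_relFac _)
  -- u030Rel with the constant `|C|·R`, as an absolute bound in `w`
  have k30abs : ∀ w : ℂ, ‖w‖ = alpha D →
      ‖innerSumLow c' χ j d r w - deriv χ.LFunction 1 * PiW χ d r * circ030 c' D j d r w‖ ≤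
        (|C| * R) * (ell D ^ 15)⁻¹ := by
    intro w hw
    have h15 : 0 ≤ (ell D ^ 15)⁻¹ := inv_nonneg.mpr (pow_nonneg hℓ.le _)
    calc ‖innerSumLow c' χ j d r w - deriv χ.LFunction 1 * PiW χ d r * circ030 c' D j d r w‖
        ≤ C * (ell D ^ 15)⁻¹ * R := k30 hA j hj d r hd hr h1 h2 w hw
      _ ≤ |C| * (ell D ^ 15)⁻¹ * R := by gcongr; exact le_abs_self C
      _ = (|C| * R) * (ell D ^ 15)⁻¹ := by ring
  have hderiv := norm_deriv_error_le c' χ hD3 j d r hd hr h1 h2 k30abs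
    (fun w hw => k31 j hj d r hd hr h1 h2 w hw)
  have hB : DifferentiableAt ℂ (bracket123 c' χ j d r) 0 :=
    (differentiable_bracket123 c' χ hD3 j d r hd hr) 0
  have hF : DifferentiableAt ℂ (F032 c' D j d r) 0 :=
    (differentiableOn_F032 c' hD3 j d r hd hr).differentiableAt
      (Metric.isOpen_ball.mem_nhds (Metric.mem_ball_self (by positivity)))
  have hsplit : deriv (fun w => bracket123 c' χ j d r w -
      deriv χ.LFunction 1 * PiW χ d r * F032 c' D j d r w) 0 =
      deriv (bracket123 c' χ j d r) 0 -
        deriv χ.LFunction 1 * PiW χ d r * deriv (F032 c' D j d r) 0 := by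
    rw [deriv_fun_sub hB (hF.const_mul _), deriv_const_mul _ hF]
  rw [hsplit, e33] at hderiv
  have hlogP1 : 0 < Real.log (Skeleton.P1 D) := log_P1_pos_three hD3
  have hid : sum122 c' χ j d r +
      1 / (Real.log (Skeleton.P1 D) : ℂ) * (deriv χ.LFunction 1 * PiW χ d r) * rhs033 c' D j d r =
      -(1 / (Real.log (Skeleton.P1 D) : ℂ)) *
        (deriv (bracket123 c' χ j d r) 0 -
          deriv χ.LFunction 1 * PiW χ d r * rhs033 c' D j d r) := by
    rw [e29]; ring
  rw [hid, norm_mul, norm_neg, norm_div, norm_one, Complex.norm_real, Real.norm_eq_abs,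
    abs_of_pos hlogP1]
  have hval : 1 / Real.log (Skeleton.P1 D) * (Real.exp π * (|C| * R) * (ell D ^ 15)⁻¹ / alpha D) =
      Real.exp π * |C| / (0.504 * π) * (ell D ^ 15)⁻¹ * R := by
    rw [log_P1_eq_ell, alpha_eq_div]
    have h9 : ell D ^ 9 ≠ 0 := pow_ne_zero _ hℓ.ne'
    have h15 : ell D ^ 15 ≠ 0 := pow_ne_zero _ hℓ.ne'
    have hπ : (π : ℝ) ≠ 0 := Real.pi_ne_zero
    field_simp
  calc 1 / Real.log (Skeleton.P1 D) *
        ‖deriv (bracket123 c' χ j d r) 0 - deriv χ.LFunction 1 * PiW χ d r * rhs033 c' D j d r‖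
      ≤ 1 / Real.log (Skeleton.P1 D) * (Real.exp π * (|C| * R) * (ell D ^ 15)⁻¹ / alpha D) :=
        mul_le_mul_of_nonneg_left hderiv (by positivity)
    _ = Real.exp π * |C| / (0.504 * π) * (ell D ^ 15)⁻¹ * R := hval

end Literature.NumberTheory.LFunctions.Zhang2022.Typed.Sec12B

/-! ## The node `Top1225Ex` at `𝓛⁻¹⁵` -/

namespace Literature.NumberTheory.LFunctions.Zhang2022.Typed.Sec12C

open Literature.NumberTheory.LFunctions.Zhang2022.Skeleton
open Literature.NumberTheory.LFunctions.Zhang2022.Typed.Sec10C.Ranges1422 (alpha_facts)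
open Literature.NumberTheory.LFunctions.Zhang2022.Repair.Bed (AssumptionAWith)

/-- Three-step triangle inequality. [cite: Zhang2022LandauSiegel, §12 (12.13) p. 71] -/
private theorem norm_sub_le_three {a b c d : ℂ} {x y z : ℝ} (h1 : ‖a - b‖ ≤ x) (h2 : ‖b - c‖ ≤ y)
    (h3 : ‖c - d‖ ≤ z) : ‖a - d‖ ≤ x + y + z :=
  calc ‖a - d‖ ≤ ‖a - b‖ + ‖b - d‖ := norm_sub_le_norm_sub_add_norm_sub _ _ _
    _ ≤ ‖a - b‖ + (‖b - c‖ + ‖c - d‖) := by gcongr; exact norm_sub_le_norm_sub_add_norm_sub _ _ _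
    _ ≤ x + (y + z) := add_le_add h1 (add_le_add h2 h3)
    _ = x + y + z := by ring

/-- `B ≤ 𝓛` for all large `D`. [cite: Zhang2022LandauSiegel, §2 p. 4] -/
private theorem forAllLarge_ell_ge (B : ℝ) : ForAllLarge fun D _ _ => B ≤ ell D := by
  refine ⟨⌈Real.exp B⌉₊, fun D _ χ hD _ _ => ?_⟩
  have hexp : Real.exp B ≤ D := le_trans (Nat.le_ceil _) (by exact_mod_cast hD)
  show B ≤ Real.log D
  exact (Real.le_log_iff_exp_le (lt_of_lt_of_le (Real.exp_pos _) hexp)).mpr hexp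

/-- `A·𝓛ᵃ/𝓛ᵇ ≤ (ε/3)α` once `3|A|/(επ) + 1 ≤ 𝓛` and `b = a + 12` (`α = π/𝓛⁹`, `𝓛 ≤ 𝓛³`).
[cite: Zhang2022LandauSiegel, §2 (2.6)] -/
private theorem small_third {A L ε : ℝ} (a : ℕ) (hε : 0 < ε) (hL1 : 1 ≤ L)
    (hL : 3 * |A| / (ε * π) + 1 ≤ L) : A * L ^ a / L ^ (a + 12) ≤ ε / 3 * (π / L ^ 9) := by
  have hL0 : 0 < L := by linarith
  have hεπ : 0 < ε * π := by positivity
  have h3 : 3 * |A| ≤ ε * π * L ^ 3 := by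
    have h1 : 3 * |A| / (ε * π) ≤ L := by linarith
    rw [div_le_iff₀ hεπ] at h1
    calc 3 * |A| ≤ L * (ε * π) := h1
      _ ≤ L ^ 3 * (ε * π) := by gcongr; exact le_self_pow₀ hL1 three_ne_zero
      _ = ε * π * L ^ 3 := by ring
  have e : A * L ^ a / L ^ (a + 12) = A / L ^ 12 := by
    rw [pow_add, ← div_div, mul_div_cancel_right₀ A (by positivity)]
  rw [e, div_le_iff₀ (by positivity)]
  calc A ≤ |A| := le_abs_self A
    _ ≤ ε * π * L ^ 3 / 3 := by linarith
    _ = ε / 3 * (π / L ^ 9) * L ^ 12 := by field_simp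

/-- **`Z22:(12.13)` in the exact reading — node `Top1225Ex` — UNDER THE MINIMUM PREMISE, UNCONDITIONAL** (`c′ ≥ 0`): for
every `ε > 0`, all large `D`, every real primitive `χ` with `‖L(1,χ)‖ ≤ 𝓛⁻¹⁵`, `𝐚₂₅ = (χϰ₁₃)‾`, `j = 1, 2, 3`:
`‖S_j(𝐚₁₂,𝐚₂₅)|_{P″₁<dr<P₂} − main1213intEx_j‖ ≤ εα`. The edge `top1225Ex_of_lemma123FormRel` verbatim over
`Section9Discharge.step9u002_sharp_pow15 (Skeleton.lemma82_pow15)`, `Section8FrontEnd82.step8u041_pow15`,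
`Sec12B.lemma123FormRel_pow15`. [cite: Zhang2022LandauSiegel, §12 (12.13) p. 71, tex L3614–L3624] -/
theorem top1225Ex_pow15 (c' : ℝ) (hc' : 0 ≤ c') :
    ∀ ε : ℝ, 0 < ε → ForAllLarge fun D _ χ => ‖χ.LFunction 1‖ ≤ 1 / Real.log D ^ 15 →
      ∀ a25 : ℕ → ℂ, (∀ n, a25 n = conj (χ (n : ZMod D) * vk13 D n)) →
        ∀ j ∈ ({1, 2, 3} : Finset ℕ),
          ‖SjOn c' D j (a12 χ) a25 (rngTop D) - main1213intEx c' χ j‖ ≤ ε * alpha D := by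
  intro ε hε
  -- the constants of the three layers
  obtain ⟨W₀, hW₀⟩ : ∃ W : ℝ,
      W = 1 + 3 * (3 * π * (1 + 5 * |c'| * π)) + 2 * (3 * π * (1 + 5 * |c'| * π)) ^ 2 := ⟨_, rfl⟩
  obtain ⟨Kw, hKw⟩ : ∃ K : ℝ, K = 3 * (1 + 5 * |c'| * π) *
      (4 + 6 * (3 * π * (1 + 5 * |c'| * π)) + 2 * (3 * π * (1 + 5 * |c'| * π)) ^ 2) := ⟨_, rfl⟩
  obtain ⟨M, hM⟩ : ∃ M : ℝ, M = 74 * (29 * W₀) + 74 * (94 * W₀ + 29 * Kw) * π := ⟨_, rfl⟩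
  obtain ⟨KI, hKI⟩ : ∃ K : ℝ, K = 16 * Real.exp 9 * W₀ *
      (5 * (29 * 521 + 0.01 * π ^ 2 * |c'|) + 11.5 * (940 * π + 29 * 531 + 0.02 * π ^ 2 * |c'|) + 6) :=
    ⟨_, rfl⟩
  have hW₀0 : 0 ≤ W₀ := by rw [hW₀]; positivity
  have hKw0 : 0 ≤ Kw := by rw [hKw]; positivity
  have hM0 : 0 ≤ M := by rw [hM]; positivity
  -- the inputs
  obtain ⟨C92, h92⟩ := Section9Discharge.step9u002_sharp_pow15 c' (lemma82_pow15 hc')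
  obtain ⟨C41, h41⟩ := Section8FrontEnd82.step8u041_pow15 hc'
  obtain ⟨C23, h23⟩ := Sec12B.lemma123FormRel_pow15 c'
  obtain ⟨CE, hE⟩ := Section8RangeEngine.weighted_sum_integral_eval c'
  set C₁ : ℝ := |C92| + |C41| + |C23| with hC₁
  have hC₁0 : 0 ≤ C₁ := by positivity
  have hC92 : C92 ≤ C₁ := by rw [hC₁]; linarith [le_abs_self C92, abs_nonneg C41, abs_nonneg C23]
  have hC41 : C41 ≤ C₁ := by rw [hC₁]; linarith [le_abs_self C41, abs_nonneg C92, abs_nonneg C23]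
  have hC23 : C23 ≤ C₁ := by rw [hC₁]; linarith [le_abs_self C23, abs_nonneg C92, abs_nonneg C41]
  obtain ⟨K, hK0, hcore⟩ := Top1225.core_topRel c' hC₁0
  -- the threshold
  have hεπ : 0 < ε * π / 3 := by positivity
  set B : ℝ := K ^ 10 / (ε * π / 3) ^ 10 + (3 * |4 * CE * M| / (ε * π) + 1) + (3 * |KI| / (ε * π) + 1)
    with hB
  refine ((((h92.and h41).and h23).and hE).and
    ((Sec10C.forAllLarge_five_c c').and (forAllLarge_ell_ge B))).mono ?_
  rintro D _ χ hq hp ⟨⟨⟨⟨H92, H41⟩, H23⟩, HE⟩, ⟨-, hℓ6, hc5⟩, hBℓ⟩ hA a25 ha25 j hj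
  have hℓ5 : 5 ≤ ell D := by linarith
  have hℓ3 : 3 ≤ ell D := by linarith
  have hℓ1 : 1 ≤ ell D := by linarith
  have hℓ0 : 0 < ell D := by linarith
  have hlog3 : 3 ≤ Real.log D := hℓ3
  obtain ⟨hα, hαeq, -⟩ := alpha_facts (D := D) hℓ3
  have h15 : ∀ {C : ℝ}, C ≤ C₁ → C * (ell D ^ 15)⁻¹ ≤ C₁ / ell D ^ 15 := by
    intro C hC; rw [div_eq_mul_inv]; exact mul_le_mul_of_nonneg_right hC (by positivity)
  -- Step 1: the core (Lemma 8.2 twice + relative Lemma 12.3)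
  have G := hcore hq hp hℓ5 j a25 ha25
    (fun d r hd hr hlt => (H92 hA j hj d r hd hr hlt).trans (h15 hC92))
    (fun d r hd hr hlt => (H41 hA j hj d r hd hr hlt).trans (h15 hC41))
    (fun d r hd hr hlo hhi => by
      rw [Top1225.nsum25_eq_sum122 c' χ hlog3 j hd hr, frakwEx_natCast, mul_neg, sub_neg_eq_add]
      refine (H23 hA j hj d r hd hr hlo hhi).trans ?_
      exact mul_le_mul_of_nonneg_right (h15 hC23) (by positivity))
  -- Step 2: (8.10) and the evaluation rule
  have S := Top1225.gathered_eval_top c' hq hℓ5 hc5 j (CE := CE) (HE j hj)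
  rw [← hW₀, ← hKw, ← hM] at S
  -- Step 3: t = Pᶻ
  have I := Top1225.top_integrals_sub_intEx c' hq hp hℓ5 hc5 hj
  rw [← hW₀, ← hKI] at I
  refine (norm_sub_le_three G S I).trans ?_
  -- Step 4: each term is at most `εα/3`
  have hB1 : K ^ 10 / (ε * π / 3) ^ 10 ≤ ell D := by
    have : 0 ≤ (3 * |4 * CE * M| / (ε * π) + 1) + (3 * |KI| / (ε * π) + 1) := by positivity
    linarith
  have hB2 : 3 * |4 * CE * M| / (ε * π) + 1 ≤ ell D := by
    have : 0 ≤ K ^ 10 / (ε * π / 3) ^ 10 := by positivity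
    have : 0 ≤ 3 * |KI| / (ε * π) + 1 := by positivity
    linarith
  have hB3 : 3 * |KI| / (ε * π) + 1 ≤ ell D := by
    have : 0 ≤ K ^ 10 / (ε * π / 3) ^ 10 := by positivity
    have : 0 ≤ 3 * |4 * CE * M| / (ε * π) + 1 := by positivity
    linarith
  have t1 : K * (ell D ^ (1.1 : ℝ)) ^ 7 / ell D ^ 17 ≤ ε / 3 * alpha D := by
    have h := Section8FrontEnd44Reduction.final_small hεπ hℓ1 hB1
    rw [hαeq]
    calc K * (ell D ^ (1.1 : ℝ)) ^ 7 / ell D ^ 17 ≤ ε * π / 3 / ell D ^ 9 := h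
      _ = ε / 3 * (π / ell D ^ 9) := by ring
  have t2 : 4 * CE * M / ell D ^ 12 ≤ ε / 3 * alpha D := by
    have h := small_third (A := 4 * CE * M) 0 hε hℓ1 hB2
    rw [hαeq]
    simpa using h
  have t3 : KI * ell D ^ 6 / ell D ^ 18 ≤ ε / 3 * alpha D := by
    rw [hαeq]
    exact small_third (A := KI) 6 hε hℓ1 hB3
  linarith

/-- **Node `Top1225Ex` under `Repair.Bed.AssumptionAWith E`, every real `E ≥ 15`, UNCONDITIONAL** (`c′ ≥ 0`; transfer per
`ε`; at the printed `E = 2022` the body of `Top1225Ex c′`, i.e. of the tree theorem `top1225Ex_holds`, not restated).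
[cite: Zhang2022LandauSiegel, §12 (12.13) p. 71] -/
theorem top1225Ex_of_assumptionAWith (c' : ℝ) (hc' : 0 ≤ c') {E : ℝ} (hE : 15 ≤ E) :
    ∀ ε : ℝ, 0 < ε → ForAllLarge fun D _ χ => AssumptionAWith E D χ →
      ∀ a25 : ℕ → ℂ, (∀ n, a25 n = conj (χ (n : ZMod D) * vk13 D n)) →
        ∀ j ∈ ({1, 2, 3} : Finset ℕ),
          ‖SjOn c' D j (a12 χ) a25 (rngTop D) - main1213intEx c' χ j‖ ≤ ε * alpha D := by
  intro ε hε
  exact Repair.Gap.forAllLarge_assumptionAWith_of_pow15 hE (top1225Ex_pow15 c' hc' ε hε)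

end Literature.NumberTheory.LFunctions.Zhang2022.Typed.Sec12C

end
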